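import Mathlib
import HarnessLib
import HarnessLib.Audit
import Summits.AtomisticToContinuum.Statement
import Literature.MathematicalPhysics.QuantumManyBody.PeriodicBoseGas
import HarnessLib.Audit.Status.Attr

/-!
Route: BECNewtonPolicyIteration

# Route BECNewtonPolicyIteration — Bogoliubov is Newton step one — policy iteration on log Ψ₀ over
the torus, each linear step inverted by tracer/sound decay (bounded correctors, no gap), landing on
a landscape bound

It suffices to show X = PeriodicLandscapeBound ∧ PeriodicRigidity ∧ BoundaryTransferWeak (card
policy-iteration-newton-riccati,
its items PI3 / PI4 / assembly tail). PeriodicLandscapeBound (the OUTPUT of the policy iteration,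
torus twin of
BECPalmLandscape.LandscapeBound): for every repulsive finite-range v, all small ρ, some C and all
large N = n+1, for EVERY δ > 0
there is a NONNEGATIVE periodic δ-near-minimiser Ψ of the torus energy (side L = (N/ρ)^{1/3}) whose
one-particle landscape ratio
∫_{cell^n} L³ m(Y)²/s(Y)² dY is ≤ C, m(Y) = ∫_cell Ψ(x,Y)² dx, s(Y) = ∫_cell Ψ(x,Y) dx (mean
participation ratio of the law of one
boson given the others; = 1 for the flat state). PeriodicRigidity: at fixed large N, periodic
δ-near-minimisers are mutually
L²(cell^N)-close up to a phase as δ → 0. BoundaryTransferWeak = BECPeriodicReduction's shared crux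
(stmt-AtomisticToContinuum-0827):
constant-mode BEC of periodic near-minimisers ⇒ the Dirichlet conjunct. The route's OWN content is
HOW PeriodicLandscapeBound is
reached: Newton's method (= Howard policy iteration) on the ground-state Riccati equation for S =
−log Ψ₀, whose n-th linear step is
a Poisson equation for the Langevin generator of the current iterate, solved WITHOUT a spectral gap
by time-integrable decay
(bounded correctors, d = 3); its typed, falsifiable core is the rank-2 crux TaggedCorrectorBound.
(Conforming re-open of the
retired draft route BECPolicyIteration, D-0027 §2.1: same items, plus the glue support
LandscapeToPeriodicBEC and a sorry-free
`closes` concluding `_root_.BoseEinsteinCondensation`.)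
Lean: `(∀ v : ℝ → ENNReal,
Literature.MathematicalPhysics.QuantumManyBody.BoseGas.IsRepulsiveFiniteRange v → ∃ ρ₀ : ℝ, 0 < ρ₀ ∧
∀ ρ : ℝ, 0 < ρ → ρ < ρ₀ → ∃ C : ℝ, 0 < C ∧ ∀ᶠ n : ℕ in Filter.atTop, ∀ δ : ENNReal, 0 < δ → ∃ Ψ :
Literature.MathematicalPhysics.QuantumManyBody.BoseGas.PeriodicTrialState (n + 1)
(Literature.MathematicalPhysics.QuantumManyBody.BoseGas.sideLength ρ (n + 1)),
Literature.MathematicalPhysics.QuantumManyBody.BoseGas.periodicEnergy v Ψ ≤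
Literature.MathematicalPhysics.QuantumManyBody.BoseGas.periodicGroundStateEnergy v (n + 1)
(Literature.MathematicalPhysics.QuantumManyBody.BoseGas.sideLength ρ (n + 1)) + δ ∧ (∀ X, Ψ.ψ X =
(‖Ψ.ψ X‖ : ℂ)) ∧ ∫⁻ Y in Literature.MathematicalPhysics.QuantumManyBody.BoseGas.cellN n
(Literature.MathematicalPhysics.QuantumManyBody.BoseGas.sideLength ρ (n + 1)), ENNReal.ofReal
(Literature.MathematicalPhysics.QuantumManyBody.BoseGas.sideLength ρ (n + 1) ^ 3) * (∫⁻ x in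
Literature.MathematicalPhysics.QuantumManyBody.BoseGas.cell
(Literature.MathematicalPhysics.QuantumManyBody.BoseGas.sideLength ρ (n + 1)), (‖Ψ.ψ (Matrix.vecCons
x Y)‖₊ : ENNReal) ^ 2) ^ 2 / (∫⁻ x in Literature.MathematicalPhysics.QuantumManyBody.BoseGas.cell
(Literature.MathematicalPhysics.QuantumManyBody.BoseGas.sideLength ρ (n + 1)), (‖Ψ.ψ (Matrix.vecCons
x Y)‖₊ : ENNReal)) ^ 2 ≤ ENNReal.ofReal C) ∧ (∀ v : ℝ → ENNReal,
Literature.MathematicalPhysics.QuantumManyBody.BoseGas.IsRepulsiveFiniteRange v → ∃ ρ₀ : ℝ, 0 < ρ₀ ∧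
∀ ρ : ℝ, 0 < ρ → ρ < ρ₀ → ∀ᶠ N : ℕ in Filter.atTop, ∀ η : ℝ, 0 < η → ∃ δ : ENNReal, 0 < δ ∧ ∀ Ψ Φ :
Literature.MathematicalPhysics.QuantumManyBody.BoseGas.PeriodicTrialState N
(Literature.MathematicalPhysics.QuantumManyBody.BoseGas.sideLength ρ N),
Literature.MathematicalPhysics.QuantumManyBody.BoseGas.periodicEnergy v Ψ ≤
Literature.MathematicalPhysics.QuantumManyBody.BoseGas.periodicGroundStateEnergy v N
(Literature.MathematicalPhysics.QuantumManyBody.BoseGas.sideLength ρ N) + δ →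
Literature.MathematicalPhysics.QuantumManyBody.BoseGas.periodicEnergy v Φ ≤
Literature.MathematicalPhysics.QuantumManyBody.BoseGas.periodicGroundStateEnergy v N
(Literature.MathematicalPhysics.QuantumManyBody.BoseGas.sideLength ρ N) + δ → ∃ c : ℂ, ‖c‖ = 1 ∧ ∫⁻
X in Literature.MathematicalPhysics.QuantumManyBody.BoseGas.cellN N
(Literature.MathematicalPhysics.QuantumManyBody.BoseGas.sideLength ρ N), (‖Ψ.ψ X - c * Φ.ψ X‖₊ :
ENNReal) ^ 2 ≤ ENNReal.ofReal η) ∧ (∀ v : ℝ → ENNReal,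
Literature.MathematicalPhysics.QuantumManyBody.BoseGas.IsRepulsiveFiniteRange v → (∃ ρ₀ : ℝ, 0 < ρ₀
∧ ∀ ρ : ℝ, 0 < ρ → ρ < ρ₀ → ∃ c : ℝ, 0 < c ∧ ∀ᶠ N : ℕ in Filter.atTop, ∃ δ : ENNReal, 0 < δ ∧ ∀ Ψ :
Literature.MathematicalPhysics.QuantumManyBody.BoseGas.PeriodicTrialState N
(Literature.MathematicalPhysics.QuantumManyBody.BoseGas.sideLength ρ N),
Literature.MathematicalPhysics.QuantumManyBody.BoseGas.periodicEnergy v Ψ ≤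
Literature.MathematicalPhysics.QuantumManyBody.BoseGas.periodicGroundStateEnergy v N
(Literature.MathematicalPhysics.QuantumManyBody.BoseGas.sideLength ρ N) + δ → ENNReal.ofReal (c * N)
≤ Literature.MathematicalPhysics.QuantumManyBody.BoseGas.condensateOccupation N
(Literature.MathematicalPhysics.QuantumManyBody.BoseGas.sideLength ρ N) Ψ.ψ) → ∃ ρ₀ : ℝ, 0 < ρ₀ ∧ ∀
ρ : ℝ, 0 < ρ → ρ < ρ₀ → Literature.MathematicalPhysics.QuantumManyBody.BoseGas.HasGroundStateBEC v
ρ)`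

## Assembly
The DECIDING THEOREM is pure logic (glue.lean, sorry-free, axioms
propext/Classical.choice/Quot.sound, rc 0 in Sketch.lean):
`theorem closes (h₁ : PeriodicLandscapeBound) (h₂ : PeriodicRigidity) (h₃ : FlatModePeriodic) (h₄ :
OccupationStabilityPeriodic)
(h₅ : LandscapeToPeriodicBEC) (h₆ : BoundaryTransferWeak) : _root_.BoseEinsteinCondensation := fun v
hv => h₆ v hv (h₅ h₁ h₂ h₃ h₄ v hv)` —
the landscape spine gives constant-mode BEC of periodic near-minimisers for v (the body of
BECPeriodicReduction.PeriodicBEC, stmt-0826,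
is thereby PROVED for v on the way; all analysis sits in the provable-now glue item
LandscapeToPeriodicBEC), and the shared boundary
transfer turns it into HasGroundStateBEC v ρ for all small ρ, i.e. the conjunct
`_root_.BoseEinsteinCondensation` (the sub-problem
Statement decl by name; it is an abbrev of
Literature.MathematicalPhysics.QuantumManyBody.BoseGas.BoseEinsteinCondensation).

Rationale: WHY THIS LINE. Write the torus ground state as Ψ₀ = e^{−S}: the eigenvalue equation is the
stationary Riccati / ergodic Hamilton–Jacobi–Bellman equation
ΔS − |∇S|² + V = E (Holland1978 minimum principle, Fleming's logarithmic transformation), and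
Howard's POLICY ITERATION for it IS the
Newton–Kantorovich method (PutermanBrumelle1979): given S_n, the correction δ_n solves the weighted
Poisson equation
∫∇δ_n·∇φ e^{−2S_n} = ∫(E_loc,n − Ē_n)φ e^{−2S_n} for the reversible Langevin generator of μ_n ∝
e^{−2S_n}, and because the nonlinearity
is exactly quadratic the new local energy is EXACTLY Ē_n − |∇δ_n|² — Rayleigh quotients decrease
monotonically (Howard improvement =
Rayleigh–Ritz), Barta brackets E₀ ∈ [Ē_n − sup|∇δ_{n−1}|², Ē_n], positivity is automatic, and from
the Dyson–Jastrow start S₀ = Σu(x_i−x_j)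
the FIRST step is the paired-phonon / Bogoliubov resummation (CampbellFeenberg1969,
ReattoChester1967 r⁻² tail, LHY-order energy gain as
in YauYin2009/Basti2022/FournaisSolovej2020): "Bogoliubov is Newton step one". The bet that replaces
the missing spectral gap
(barrier KineticGapLengthScales; the audits' objection to Kirkwood–Thomas-type contractions
KirkwoodThomas1983, DattaKennedy2002) is
that each linear step is solvable in SUP norm because local disturbances of the iterate's Langevin
gas are carried away integrably fast
in d = 3 — a tagged particle is a transient tracer (t^{−3/2}; Kipnis–Varadhan H₋₁ theory
KipnisVaradhan1986, interacting Brownian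
particles Osada1998, bounded correctors in stochastic homogenisation for d ≥ 3
GloriaOtto2011/GloriaNeukammOtto2014) and collective
density modes relax at the de Gennes rate k²/S(k) ≍ c|k| ("sound in imaginary time", S(k) ≍ |k| by
the Reatto–Chester tail); the
remaining Newton steps are a Nash–Moser scheme (Hamilton1982NashMoser) in locality-graded,
power-weighted kernel norms. Imported areas:
stochastic control (log transform, PI = Newton), hard implicit-function schemes, and the probability
of reversible particle systems
(correctors/transience); physics enters only as calibration of step one. Versus prior routes:
BECPalmLandscape reaches the (Dirichlet)
landscape by Debye screening of the Feynman–Kac path gas — same target object, disjoint mechanism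
(its planner foresaw the torus twin
filed here); BECRenormGroup flowed a complex action, this flows a positive function; the boundary
transfer 0827 is shared with the open
routes BECGroundStateSOS / BECMeanFieldControl (its owner BECPeriodicReduction was retired in the
D-0027 §2.1 audit); negatives index empty.

RANKED CRUXES. #2 TaggedCorrectorBound (crux) — (typed core of card item PI1, at the fixed point and
in L²: "no gap, transience instead") for every repulsive finite-range v, all small ρ, some C, all
large N = n+1 and every δ > 0 there is a nonnegative periodic δ-near-minimiser Ψ on the torus of
side L = (N/ρ)^{1/3} such that for every continuous one-body observable f with |f| ≤ 1 supported in
a ball of radius 1 and every C¹ periodic test function φ of all N coordinates: Cov_{Ψ²}(f(x₀), φ)² ≤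
(C/L³)·∫|∇φ|²Ψ² — i.e. the H₋₁(Ψ²dX) norm of the centred tagged-particle observable f(x₀) − ⟨f(x₀)⟩
is ≤ C/L³ UNIFORMLY IN THE VOLUME (L³ = N/ρ is the tagged particle's dilution; free gas: C → 8π/15).
Equivalently ∫₀^∞ Cov(f(x₀(0)), f(x₀(t))) dt ≤ C/(2L³)·… for the stationary ground-state Langevin
diffusion: the tagged boson is a transient tracer. A fixed-box Poincaré inequality only gives C ∝
L², so the content is exactly gap-free solvability of the Newton step for tagged sources; its
failure kills the sup-norm (bounded-corrector) estimate the scheme needs a fortiori. [difficulty: L]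
(why it might fail: The ground-state point process is hyperuniform (S(k) ≍ |k| from the
Reatto–Chester r⁻² tail of log Ψ₀²); rigidity of that kind makes tracers sub-diffusive in Osada's
Ginibre interacting Brownian motions, and hard cores can cage — then C = C(L) ↑ ∞.)
[KipnisVaradhan1986, Osada1998, doi:10.1016/s0246-0203(98)80031-9, GloriaOtto2011,
GloriaNeukammOtto2014, ReattoChester1967, GhoshPeres2017, doi:10.21203/rs.3.rs-3656775/v1]
#3 PeriodicLandscapeBound (crux) — (card item PI3, output of the scheme; torus twin of
BECPalmLandscape.LandscapeBound = stmt-AtomisticToContinuum-3297) ∀ admissible v ∃ρ₀ ∀ρ<ρ₀ ∃C ∀ᶠ n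
∀δ>0 ∃Ψ ∈ PeriodicTrialState (n+1) L, L = ((n+1)/ρ)^{1/3}, periodic δ-near-minimiser, Ψ ≥ 0
pointwise, with ∫_{cell^n} L³ m(Y)²/s(Y)² dY ≤ C, m(Y) = ∫_cell |Ψ(x,Y)|² dx, s(Y) = ∫_cell |Ψ(x,Y)|
dx (E_Q[R] ≤ C, R = participation ratio of the conditional one-body law; flat state R ≡ 1; expected
1 + O(√(ρa³))). The policy iterates e^{−S_n} are positive states with Rayleigh quotients ↓
E₀^per(N,L) at fixed N (so every δ is reached), and R along them is exp(O(Σ_n one-particle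
oscillation of δ_n)), bounded uniformly in L by the tame corrector estimates (TameNewtonScheme,
filed informal). [deps: TaggedCorrectorBound] [difficulty: open-problem] (why it might fail: If the
a/r → r⁻² tail of the two-body part of S is not reproduced with summable one-particle oscillations,
Var of the landscape grows like log(L/ξ) and E_Q[R] → ∞ slowly (only λ_max ≥ N^{1−C√(ρa³)} would
survive); rare dense-cluster baths Y give heavy tails of R.) [ReattoChester1967, Reatto1969,
McMillan1965, GirvinMacdonald1987, LSSY2005, KirkwoodThomas1983]
#5 PeriodicRigidity (crux) — (card item PI4, torus twin of BECPalmLandscape.GroundStateRigidity =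
stmt-AtomisticToContinuum-3298) ∀ admissible v ∃ρ₀ ∀ρ<ρ₀ ∀ᶠ N ∀η>0 ∃δ>0: any two periodic
δ-near-minimisers Ψ, Φ ∈ PeriodicTrialState N L (L = (N/ρ)^{1/3}) satisfy ∫_{cell^N}|Ψ − cΦ|² ≤ η
for some unit complex c (E₀^per < ∞ at low density, compact resolvent of the torus N-body operator,
unique positive ground state by positivity improvement, spectral gap at fixed N; hard cores via
energetic dominance / connectivity of the dilute component of configuration space). [difficulty: M]
(why it might fail: v = ⊤ walls (hard cores, impenetrable shells) disconnect the torus configuration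
space; uniqueness then needs every non-dilute component (jammed clusters, winding sectors) to lie an
N-uniform gap above E₀ — connectivity of hard-sphere configuration spaces at low density is open in
general.) [ReedSimonIV1978, doi:10.1093/imrn/rnt012, LSSY2005]
#6 BoundaryTransferWeak (crux) — (shared verbatim with BECPeriodicReduction / BECVortexSheetDuality:
stmt-AtomisticToContinuum-0827) for each repulsive finite-range v, constant-mode BEC of periodic
δ-near-minimisers on the torus of side (N/ρ)^{1/3} at all small ρ implies ∃ρ₀>0 ∀ρ∈(0,ρ₀)
HasGroundStateBEC v ρ (Dirichlet ground state, mode-free λ_max criterion). Only the ENERGY analogue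
of this transfer is in print (LSSY2005 Ch. 2 after (2.8)); expected via Neumann bracketing of
interior sub-boxes + λ_max(γ) ≥ tr γ²/N. [difficulty: L] (why it might fail: The hypothesis is
ground-state-only at the box (N/ρ)^{1/3}: the Dirichlet ground state restricted to sub-boxes is
neither periodic nor of sharp N nor a near-minimiser, so the hypothesis may never fire (transfer ≈
conjunct); BEC is BC-sensitive (Robinson 1976).) [LSSY2005, Junge2026, Basti2022,
BoccatoSeiringer2023, doi:10.1007/bf01608554]
#9 FlatModePeriodic (support) — for L > 0 and Ψ ∈ PeriodicTrialState (n+1) L with Ψ ≥ 0 pointwise: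
(n+1) ≤ condensateOccupation (n+1) L Ψ · ∫_{cell^n} L³ m²/s² dY (Fubini for x::Y on the cell, ∫m = 1
by normalisation, Cauchy–Schwarz m = (s L^{−3/2})·(L^{3/2} m/s); condensateOccupation = (n+1) L^{−3}
∫_{cell^n} |∫_cell Ψ(x,Y)dx|² dY by unfolding constantMode and the cell indicators; s = 0 ⇒ m = 0).
[difficulty: provable-now] [PenroseOnsager1956, LSSY2005, Fournais2020]
#9 OccupationStabilityPeriodic (support) — for periodic trial states Ψ, Φ ∈ PeriodicTrialState N L
and |c| = 1: condensateOccupation(Ψ)^{1/2} ≤ condensateOccupation(Φ)^{1/2} + N^{1/2}·‖Ψ −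
cΦ‖_{L²(cell^N)} (F_Ψ(Y) = L^{−3/2}∫_cell Ψ(x,Y)dx, |F_Ψ − cF_Φ|(Y) ≤ ‖(Ψ − cΦ)(·,Y)‖_{L²(cell)} by
Cauchy–Schwarz on the cell, Minkowski in L²(dY), occupation of cΦ = occupation of Φ). [difficulty:
provable-now] [LSSY2005, Fournais2020]
#9 LandscapeToPeriodicBEC (support) — (assembly glue, provable now) PeriodicLandscapeBound →
PeriodicRigidity → FlatModePeriodic → OccupationStabilityPeriodic → for every admissible v the body
of BECPeriodicReduction.PeriodicBEC (stmt-0826): ∃ρ₀ ∀ρ<ρ₀ ∃c>0 ∀ᶠN ∃δ>0, every periodic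
δ-near-minimiser on the torus of side (N/ρ)^{1/3} has condensateOccupation ≥ cN. Proof: ρ₀ = min of
the two ρ₀'s, c = 1/(4C); eventually in N = n+1 take η = 1/(4C) in PeriodicRigidity to get δ, the
positive δ-near-minimiser Ψ of PeriodicLandscapeBound has condensateOccupation ≥ N/C by
FlatModePeriodic, and OccupationStabilityPeriodic transfers ≥ N/(4C) to every δ-near-minimiser Φ;
ENNReal / rpow(1/2) / `tendsto_add_atTop_nat` bookkeeping only. [difficulty: provable-now]
[LSSY2005, PenroseOnsager1956, Fournais2020]

TWO-LAYER PLAN. Foreseen, nothing filed as a split now. PeriodicLandscapeBound ⇐ TameNewtonScheme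
(informal crux, rank 4, filed right after open: tame
sup-norm corrector bounds for the iterates' Poisson equations + closure of r_{n+1} = |∇δ_n|² in
power-weighted locality-graded kernel
norms + smallness after step one) → FixedBoxConvergence (Ē_n ↓ E₀^per(N,L) at fixed N, L; a gapped,
Kirkwood–Thomas-sized statement) →
PeriodicLandscapeBound, glue = "landscape ratio ≤ exp(C Σ_n osc δ_n)". TaggedCorrectorBound is the
typed n = ∞, L²-level shadow of the
tame inverse and is expected to be its first proved instance (then: sources local in the tagged
particle's ENVIRONMENT Σ_j f(x₀,x_j),
then sup-norm). PeriodicRigidity ⇐ FiniteEnergy → UniqueGappedTorusGroundState → PeriodicRigidity.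
If BoundaryTransferWeak stalls:
the Dirichlet-direct variant of the same scheme (start S₀ + Σ_i w(x_i) with a Gross–Pitaevskii wall
profile) lands on
BECPalmLandscape.LandscapeBound (stmt-3297) with the PROVED tail bec_of_zeroMode — filed then as an
alternative decomposition sharing 3297.

KILL CRITERIA. ¬TaggedCorrectorBound (some admissible v, arbitrarily small ρ: the tagged corrector's
H₋₁ norm ≫ L⁻³, e.g. a sub-diffusive or caged
tracer in the ground-state diffusion) closes the route `refuted:TaggedCorrectorBound` — no bounded
correctors, no solvable Newton step in
the norms the landscape needs; the witness goes to BECPalmLandscape as evidence about screening.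
¬PeriodicLandscapeBound (E_Q[R] → ∞ on
the torus for positive near-minimisers) closes this route and the torus twin of BECPalmLandscape;
pivot only if the divergence sits in
the lower tail of s (then the weaker E[BC²] ≥ c form). ¬PeriodicRigidity for hard cores: restate
both landscape routes for finite v
(the conjunct for v with ⊤ values would then need another frame). ¬BoundaryTransferWeak kills the
torus framing, not the mechanism:
pivot to the Dirichlet-direct variant (Two-layer plan). A one-loop computation showing that osc(δ₁)
or |||r₂||| carries log(L/ξ) with a
coefficient that does not square away (loss in L, not in the smoothing scale) retires
TameNewtonScheme and with it the card. Mooted by: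
PeriodicBEC (0826) or X_B1 / LandscapeBound proved elsewhere.

NOT DECOMPOSED YET. The scheme itself (definition layer wanted: weighted Dirichlet form / corrector
of a positive periodic C¹ function; k-body kernel norms
with power weights — plain L¹ kernel norms are excluded by the Reatto–Chester r⁻² tail); the
fixed-box convergence Ē_n ↓ E₀^per (gapped,
constants may depend on N, L); the large-field / dense-cluster truncation that must accompany
Nash–Moser smoothing while keeping
e^{−S_n} > 0; hard cores inside the iteration (S₀ = +∞ on cores, reflected/killed diffusion); the
step-one calibration theorem (LHY-order
gain Ē₁ − Ē₂, an energy statement, deliberately NOT an item: barrier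
EnergyAsymptoticsWithoutCondensation); the environment-local and
sup-norm strengthenings of TaggedCorrectorBound; existence of nonnegative C¹ near-minimisers for
every δ (|Ψ| smoothing). All are
layer-2 children or `--supports` lemmas.

CHEAPEST FALSIFIER. (i) By hand, v ≡ 0 (admissible): Ψ = flat state, tracer = free Brownian motion
on the 3-torus, sup over |f| ≤ 1 in a unit ball of
‖f − f̄‖²_{Ḣ⁻¹} = ∬_{B×B} dxdy/(4π|x−y|) = 8π/15 ≈ 1.676, so TaggedCorrectorBound holds with any C >
8π/15 eventually in n; landscape ratio ≡ 1;
FlatModePeriodic is an equality — consistent (checked 2026-08-15). (ii) The card's test (i): compute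
r₁ = |∇δ₀|² at Bogoliubov level and the
one-particle oscillation of δ₁ = L₁⁻¹r̃₁ at one loop — a log(L/ξ) that does not square away kills
TameNewtonScheme. (iii) kit (not run; hub
compute-free for this unit): overdamped Langevin dynamics of N = 10³–10⁴ particles with the Jastrow
drift −2Σ∇u at ρa³ = 10⁻³: tagged MSD/t
and the corrector of a unit-ball indicator vs L ∈ {10, 20, 40}ρ^{−1/3} — a drift of C with L retires
TaggedCorrectorBound's step-one instance.
(iv) 1-D control: recurrent tracer, TaggedCorrectorBound false, landscape log-correlated — the
scheme fails where BEC fails.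

NUMBERS. C_free = 8π/15 = 1.6755 (TaggedCorrectorBound at v = 0, L → ∞; torus correction O(1/L));
expected interacting C = (8π/15)(1 + o(1)) as
ρa³ → 0 (Kipnis–Varadhan drag ‖drift‖²₋₁ = O(ρa³) heuristically). Landscape ratio: flat torus state
≡ 1 (Dirichlet free gas (π²/8)³ = 1.878,
BECPalmLandscape); expected 1 + O(√(ρa³)). Step one: Ē₁ ≤ 4πaρ₁N(1 + C a/b) (LSSY2005 Thm 2.2
(2.14), in tree as LSSY2005_upperBound_periodic);
LHY: e₀ = 4πaρ(1 + (128/(15√π))√(ρa³) + o(√(ρa³))) (FournaisSolovej2020 lower, YauYin2009 /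
Basti2022 upper). Units ħ = 2m = 1: Bogoliubov
e(k) = k√(k² + 16πρa), Feynman S(k) = k²/e(k) → |k|/c, sound speed c = √(16πρa), healing length ξ =
(8πρa)^{−1/2}; imaginary-time (de Gennes)
relaxation rate of the density mode k²/S(k) = e(k) → c|k|; tracer decay t^{−3/2}. Items at open: 8
(typed cruxes TaggedCorrectorBound,
PeriodicLandscapeBound, PeriodicRigidity, shared BoundaryTransferWeak; supports FlatModePeriodic,
OccupationStabilityPeriodic,
LandscapeToPeriodicBEC; Assembly); after open: informal crux TameNewtonScheme (rank 4), informal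
support PolicyImprovementIdentity; the
definition requests defn-WeightedCorrector and defn-KernelNorm are already filed — 10 items in all.

DEFINITION REQUESTS. After open: (1) `WeightedCorrector` (topic
Literature/MathematicalPhysics/QuantumManyBody): for a positive C¹ periodic F on Config N and a
centred observable g, the Dirichlet form 𝓔_F(φ) = ∫_{cell^N}|∇φ|²F², the H₋₁(F²) norm sup_φ{2∫gφF² −
𝓔_F(φ)} and the weak corrector
(solution of ∫∇δ·∇φF² = ∫gφF² ∀φ) — the "Langevin generator of a positive trial function" of the
card, needed to type TameNewtonScheme
and PolicyImprovementIdentity; (2) `KernelNorm` (topic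
Summits/AtomisticToContinuum/BoseEinsteinCondensation/Theorems, new object):
symmetric functions presented as Σ_k Σ_{i₁<…<i_k} u_k with power-weighted sup norms sup
Π(1+dist)^{p} |u_k| and a locality grading ℓ.
No cite facts requested (Barta's inequality and the H₋₁/time-integral identity are short proofs).

Novelty: Searches (2026-08-15; local searchd tier DOWN (connection reset ×3), OpenAlex HTTP 429; remote tiers
used): `lit search --source zbmath`
×8 ("policy iteration Newton-Kantorovich …" → doi:10.1287/moor.4.1.60; "Kipnis Varadhan …" →
doi:10.1007/bf01210789; "Gloria Otto optimal
variance …" → doi:10.1214/10-aop571; "logarithmic transformations stochastic control Fleming" →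
zbl:0502.93076; "Holland principal
eigenvalue …" → zbl:0458.35074; "self-diffusion interacting Brownian particles hard core" →
doi:10.1007/s004400050183; "Kirkwood Thomas
expansions …" 0; "Newton iteration ground state Schrödinger many-body logarithm" 0); `lit search
--source crossref` ×5 (KirkwoodThomas1983
doi:10.1007/bf01211959; Holland1978 doi:10.1002/cpa.3160310406; Osada AIHP 1998
doi:10.1016/s0246-0203(98)80031-9 and
doi:10.21203/rs.3.rs-3656775/v1 (Ginibre IBM sub-diffusive); GloriaOtto JEMS 2017
doi:10.4171/jems/745, MourratOtto doi:10.1214/15-aop1045;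
policy iteration risk-sensitive ergodic control: doi:10.1287/opre.2024.0818,
doi:10.1109/cdc.1992.371436 — finite-dimensional/control only);
`lit galaxy search --star all` ×3 ("paired-phonon analysis" → Feenberg, Theory of Quantum Fluids
panama:184666413858821 + PRB 22, 206;
"policy iteration principal eigenfunction" 0; "self-diffusion interacting Brownian particles" 0);
`lit frontier AtomisticToContinuum --since
2021` (BEC descendants arXiv:2603.20776, arXiv:2510.20493 only — energy-window lines); `lit bridges
AtomisticToContinuum --cross any` (no
Bose-g  [refs: 10.1287/moor.4.1.60, 10.1007/bf01210789, 10.1214/10-aop571, 10.1007/s004400050183, 10.1007/bf01211959, 10.1002/cpa.3160310406, 10.1016/s0246-0203(98, 10.21203/rs.3.rs-3656775/v1, 10.4171/jems/745, 10.1214/15-aop1045, 10.1287/opre.2024.0818, 10.1109/cdc.1992.371436, 2603.20776, 2510.20493, doi:10.1287/moor.4.1.60, doi:10.1007/bf01210789, doi:10.1214/10-aop571, doi:10.1007/s004400050183, doi:10.1007]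

Barriers (technique_class: policy-iteration nash-moser riccati corrector-decay): - technique_class: policy-iteration nash-moser riccati corrector-decay
- Literature.Barriers.AtomisticToContinuum.BogoliubovPerturbationInfrared: not in its class —
nothing is expanded in the particle (ψ, ψ̄) representation; the unknown is log Ψ₀, a
positive-amplitude / hydrodynamic variable (the Narrow entry's non-covered case (ii)), the scheme is
quadratically convergent Newton, and every μ_n is a positive measure (no complex Gaussian, no
large-field problem of BFKT type); conceded: the d = 3 marginal logarithm can re-enter as a per-step
loss in L rather than in the smoothing scale — that is TameNewtonScheme's stated kill signal.
- Literature.Barriers.AtomisticToContinuum.BogoliubovPerturbationInfraredNarrow: as above; the route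
sits in its exit (ii) (amplitude parametrisation, IR-finite term by term) and uses Bogoliubov theory
only as the calibration of step one.
- Literature.Barriers.AtomisticToContinuum.KineticGapLengthScales: evaded — no energy window and no
gap at scale L anywhere: linear steps are inverted by transience/decay (TaggedCorrectorBound is
precisely "uniform in L where a Poincaré inequality gives L²"), condensation is read off positivity
+ landscape (the Narrow entry's exit (b), with genuinely three-dimensional input: t^{−3/2}
transience, S(k) ≍ |k|); δ is chosen after N only for fixed-N rigidity.
- Literature.Barriers.AtomisticToContinuum.KineticGapLengthScalesNarrow: respected — the boost/phase
witnesses are complex; all our states are positive, and the c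

Novelty grade: new-combination — refuter rreview-0815T13-7-0 (route-review seat; grade CARRIED from card audits 8/12 of policy-iteration-newton-riccati, endorsed there after zbMATH/crossref/galaxy searches; no new search by this seat): Newton = Howard policy iteration on the ground-state Riccati/HJB equation with exact quadratic re (refuter refuter-rreview-0815T13-7-0, 2026-08-15T14:17:58Z; prior: Kirkwood-Thomas doi:10.1007/bf01211959; Puterman-Brumelle Math.Oper.Res. 4:60 (1979); Campbell-Feenberg PR 188:396 (1969) / Reatto-Chester doi:10.1103/physrev.155.88; Kipnis-Varadhan doi:10.1007/bf01210789; Gloria-Otto doi:10.1214/10-aop571; Kerimkulov-Siska-Szpruch SICON 2020)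

History (route lifecycle, newest last):
- 2026-08-25T01:32:06Z · DORMANT — reconciler: no traction for 7.3 d (last activity item-evidence-added at 2026-08-17T18:55:01Z); parked, not closed — `ledger route dormant route-AtomisticToConti (operator:999:3805550)
- 2026-08-29T03:24:06Z · REACTIVATED — reconciler: reactivated — activity statement-checked at 2026-08-29T01:17:37Z after parking at 2026-08-25T01:32:06Z (operator:999:9160)

sub-problem: BoseEinsteinCondensation · status: open · opened planner-plancard-AtomisticToContinuum-BoseEin-0d855b1c-0 2026-08-15T13:43:57Z · rev 2 · ledger route-AtomisticToContinuum-BECNewtonPolicyIteration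
GENERATED by the gate from the ledger (D-0016/17). Provers cite these decls: `theorem foo : Summit.AtomisticToContinuum.BoseEinsteinCondensation.Theses.BECNewtonPolicyIteration.<Decl> := …` in Summits/AtomisticToContinuum/BoseEinsteinCondensation/Theorems/<Name>.lean.
-/

namespace Summit.AtomisticToContinuum.BoseEinsteinCondensation.Theses.BECNewtonPolicyIteration

open scoped BigOperators Topology Manifold Classical MeasureTheory ProbabilityTheory Matrix InnerProductSpace ComplexConjugate ContinuousMap
open Filter Set Function TopologicalSpace MeasureTheory

attribute [summit_statement] _root_.BoseEinsteinCondensation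

/-- item stmt-AtomisticToContinuum-8956 · crux · rank 2 · open · by planner
why it might fail: The ground-state point process is hyperuniform (S(k) ≍ |k| from the Reatto–Chester r⁻² tail of log Ψ₀²); rigidity of that kind makes tracers sub-diffusive in Osada's Ginibre interacting Brownian motions, and hard cores can cage — then C = C(L) ↑ ∞.
sources: KipnisVaradhan1986, Osada1998, doi:10.1016/s0246-0203(98)80031-9, GloriaOtto2011, GloriaNeukammOtto2014, ReattoChester1967
[crux] (typed core of card item PI1, at the fixed point and in L²: "no gap, transience instead") for
every repulsive finite-range v, all small ρ, some C, all large N = n+1 and every δ > 0 there is a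
nonnegative periodic δ-near-minimiser Ψ on the torus of side L = (N/ρ)^{1/3} such that for every
continuous one-body observable f with |f| ≤ 1 supported in a ball of radius 1 and every C¹ periodic
test function φ of all N coordinates: Cov_{Ψ²}(f(x₀), φ)² ≤ (C/L³)·∫|∇φ|²Ψ² — i.e. the H₋₁(Ψ²dX)
norm of the centred tagged-particle observable f(x₀) − ⟨f(x₀)⟩ is ≤ C/L³ UNIFORMLY IN THE VOLUME (L³
= N/ρ is the tagged particle's dilution; free gas: C → 8π/15). Equivalently ∫₀^∞ Cov(f(x₀(0)),
f(x₀(t))) dt ≤ C/(2L³)·… for the stationary ground-state Langevin diffusion: the tagged boson is a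
transient tracer. A fixed-box Poincaré inequality only gives C ∝ L², so the content is exactly
gap-free solvability of the Newton step for tagged sources; its failure kills the sup-norm
(bounded-corrector) estimate the scheme needs a fortiori. [difficulty: L] -/
@[route_item "route-AtomisticToContinuum-BECNewtonPolicyIteration"]
def TaggedCorrectorBound : Prop :=
  ∀ v : ℝ → ENNReal, Literature.MathematicalPhysics.QuantumManyBody.BoseGas.IsRepulsiveFiniteRange v → ∃ ρ₀ : ℝ, 0 < ρ₀ ∧ ∀ ρ : ℝ, 0 < ρ → ρ < ρ₀ → ∃ C : ℝ, 0 < C ∧ ∀ᶠ n : ℕ in Filter.atTop, ∀ δ : ENNReal, 0 < δ → ∃ Ψ : Literature.MathematicalPhysics.QuantumManyBody.BoseGas.PeriodicTrialState (n + 1) (Literature.MathematicalPhysics.QuantumManyBody.BoseGas.sideLength ρ (n + 1)), Literature.MathematicalPhysics.QuantumManyBody.BoseGas.periodicEnergy v Ψ ≤ Literature.MathematicalPhysics.QuantumManyBody.BoseGas.periodicGroundStateEnergy v (n + 1) (Literature.MathematicalPhysics.QuantumManyBody.BoseGas.sideLength ρ (n + 1)) + δ ∧ (∀ X, Ψ.ψ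 X = (‖Ψ.ψ X‖ : ℂ)) ∧ ∀ (c : Literature.MathematicalPhysics.QuantumManyBody.BoseGas.Space) (f : Literature.MathematicalPhysics.QuantumManyBody.BoseGas.Space → ℝ), Continuous f → (∀ x, ‖f x‖ ≤ 1) → (∀ x, f x ≠ 0 → dist x c ≤ 1) → ∀ φ : Literature.MathematicalPhysics.QuantumManyBody.BoseGas.Config (n + 1) → ℝ, ContDiff ℝ 1 φ → (∀ (X : Literature.MathematicalPhysics.QuantumManyBody.BoseGas.Config (n + 1)) (i : Fin (n + 1)) (k : Fin 3), φ (X + Pi.single i (EuclideanSpace.single k (Literature.MathematicalPhysics.QuantumManyBody.BoseGas.sideLength ρ (n + 1)))) = φ X) → (∫ X in Literature.MathematicalPhysics.QuantumManyBody.BoseGas.cellN (n + 1) (Literature.MathematicalPhysics.QuantumManyBody.BoseGas.sideLength ρ (n + 1)), (f (X 0) - ∫ Y in Literature.MathematicalPhysics.QuantumManyBody.BoseGas.cellN (n + 1) (Literature.MathematicalPhysics.QuantumManyBody.BoseGas.sideLength ρ (n + 1)), f (Y 0) * ‖Ψ.ψ Y‖ ^ 2) * φ X * ‖Ψ.ψ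 X‖ ^ 2) ^ 2 ≤ C / (Literature.MathematicalPhysics.QuantumManyBody.BoseGas.sideLength ρ (n + 1)) ^ 3 * ∫ X in Literature.MathematicalPhysics.QuantumManyBody.BoseGas.cellN (n + 1) (Literature.MathematicalPhysics.QuantumManyBody.BoseGas.sideLength ρ (n + 1)), (∑ i : Fin (n + 1), ∑ k : Fin 3, (fderiv ℝ φ X (Pi.single i (EuclideanSpace.single k (1 : ℝ)))) ^ 2) * ‖Ψ.ψ X‖ ^ 2

/-- item stmt-AtomisticToContinuum-8957 · crux · rank 3 · open · by planner
why it might fail: If the a/r → r⁻² tail of the two-body part of S is not reproduced with summable one-particle oscillations, Var of the landscape grows like log(L/ξ) and E_Q[R] → ∞ slowly (only λ_max ≥ N^{1−C√(ρa³)} would survive); rare dense-cluster baths Y give heavy tails of R.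
sources: ReattoChester1967, Reatto1969, McMillan1965, GirvinMacdonald1987, LSSY2005, KirkwoodThomas1983
[crux] (card item PI3, output of the scheme; torus twin of BECPalmLandscape.LandscapeBound =
stmt-AtomisticToContinuum-3297) ∀ admissible v ∃ρ₀ ∀ρ<ρ₀ ∃C ∀ᶠ n ∀δ>0 ∃Ψ ∈ PeriodicTrialState (n+1)
L, L = ((n+1)/ρ)^{1/3}, periodic δ-near-minimiser, Ψ ≥ 0 pointwise, with ∫_{cell^n} L³ m(Y)²/s(Y)²
dY ≤ C, m(Y) = ∫_cell |Ψ(x,Y)|² dx, s(Y) = ∫_cell |Ψ(x,Y)| dx (E_Q[R] ≤ C, R = participation ratio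
of the conditional one-body law; flat state R ≡ 1; expected 1 + O(√(ρa³))). The policy iterates
e^{−S_n} are positive states with Rayleigh quotients ↓ E₀^per(N,L) at fixed N (so every δ is
reached), and R along them is exp(O(Σ_n one-particle oscillation of δ_n)), bounded uniformly in L by
the tame corrector estimates (TameNewtonScheme, filed informal). [deps: TaggedCorrectorBound]
[difficulty: open-problem] -/
@[route_item "route-AtomisticToContinuum-BECNewtonPolicyIteration", crux]
def PeriodicLandscapeBound : Prop :=
  ∀ v : ℝ → ENNReal, Literature.MathematicalPhysics.QuantumManyBody.BoseGas.IsRepulsiveFiniteRange v → ∃ ρ₀ : ℝ, 0 < ρ₀ ∧ ∀ ρ : ℝ, 0 < ρ → ρ < ρ₀ → ∃ C : ℝ, 0 < C ∧ ∀ᶠ n : ℕ in Filter.atTop, ∀ δ : ENNReal, 0 < δ → ∃ Ψ : Literature.MathematicalPhysics.QuantumManyBody.BoseGas.PeriodicTrialState (n + 1) (Literature.MathematicalPhysics.QuantumManyBody.BoseGas.sideLength ρ (n + 1)), Literature.MathematicalPhysics.QuantumManyBody.BoseGas.periodicEnergy v Ψ ≤ Literature.MathematicalPhysics.QuantumManyBody.BoseGas.periodicGroundStateEnergy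 v (n + 1) (Literature.MathematicalPhysics.QuantumManyBody.BoseGas.sideLength ρ (n + 1)) + δ ∧ (∀ X, Ψ.ψ X = (‖Ψ.ψ X‖ : ℂ)) ∧ ∫⁻ Y in Literature.MathematicalPhysics.QuantumManyBody.BoseGas.cellN n (Literature.MathematicalPhysics.QuantumManyBody.BoseGas.sideLength ρ (n + 1)), ENNReal.ofReal (Literature.MathematicalPhysics.QuantumManyBody.BoseGas.sideLength ρ (n + 1) ^ 3) * (∫⁻ x in Literature.MathematicalPhysics.QuantumManyBody.BoseGas.cell (Literature.MathematicalPhysics.QuantumManyBody.BoseGas.sideLength ρ (n + 1)), (‖Ψ.ψ (Matrix.vecCons x Y)‖₊ : ENNReal) ^ 2) ^ 2 / (∫⁻ x in Literature.MathematicalPhysics.QuantumManyBody.BoseGas.cell (Literature.MathematicalPhysics.QuantumManyBody.BoseGas.sideLength ρ (n + 1)), (‖Ψ.ψ (Matrix.vecCons x Y)‖₊ : ENNReal)) ^ 2 ≤ ENNReal.ofReal C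

-- item stmt-AtomisticToContinuum-9294 · crux · rank 4 · open · by planner — informal only, no Lean statement yet:
--   [crux] TAME NEWTON (POLICY-ITERATION) SCHEME FOR log Ψ₀ ON THE TORUS — card items PI1 + PI2;
--   informal until the corrector / kernel-norm layer is typed (definition requests WeightedCorrector,
--   KernelNorm). Setting: torus of side L = (N/ρ)^{1/3}, H = −Δ + Σ_{i<j} v^per(x_i − x_j); positive
--   symmetric periodic F_n = e^{−S_n}, μ_n := F_n²dX/∫F_n²; L_n := the μ_n-symmetric diffusion generator
--   with Dirichlet form ∫|∇φ|²dμ_n (drift 2∇log F_n); local energy E_loc,n := (HF_n)/F_n = ΔS_n −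
--   |∇S_n|² + V; Ē_n := ⟨E_loc,n⟩_{μ_n} = Rayleigh quotient of F_n. Newton = Howard policy-iteration
--   step: δ_n solves the

/-- item stmt-AtomisticToContinuum-8958 · crux · rank 5 · open · by planner
why it might fail: v = ⊤ walls (hard cores, impenetrable shells) disconnect the torus configuration space; uniqueness then needs every non-dilute component (jammed clusters, winding sectors) to lie an N-uniform gap above E₀ — connectivity of hard-sphere configuration spaces at low density is open in general.
sources: ReedSimonIV1978, doi:10.1093/imrn/rnt012, LSSY2005
[crux] (card item PI4, torus twin of BECPalmLandscape.GroundStateRigidity =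
stmt-AtomisticToContinuum-3298) ∀ admissible v ∃ρ₀ ∀ρ<ρ₀ ∀ᶠ N ∀η>0 ∃δ>0: any two periodic
δ-near-minimisers Ψ, Φ ∈ PeriodicTrialState N L (L = (N/ρ)^{1/3}) satisfy ∫_{cell^N}|Ψ − cΦ|² ≤ η
for some unit complex c (E₀^per < ∞ at low density, compact resolvent of the torus N-body operator,
unique positive ground state by positivity improvement, spectral gap at fixed N; hard cores via
energetic dominance / connectivity of the dilute component of configuration space). [difficulty: M] -/
@[route_item "route-AtomisticToContinuum-BECNewtonPolicyIteration", crux]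
def PeriodicRigidity : Prop :=
  ∀ v : ℝ → ENNReal, Literature.MathematicalPhysics.QuantumManyBody.BoseGas.IsRepulsiveFiniteRange v → ∃ ρ₀ : ℝ, 0 < ρ₀ ∧ ∀ ρ : ℝ, 0 < ρ → ρ < ρ₀ → ∀ᶠ N : ℕ in Filter.atTop, ∀ η : ℝ, 0 < η → ∃ δ : ENNReal, 0 < δ ∧ ∀ Ψ Φ : Literature.MathematicalPhysics.QuantumManyBody.BoseGas.PeriodicTrialState N (Literature.MathematicalPhysics.QuantumManyBody.BoseGas.sideLength ρ N), Literature.MathematicalPhysics.QuantumManyBody.BoseGas.periodicEnergy v Ψ ≤ Literature.MathematicalPhysics.QuantumManyBody.BoseGas.periodicGroundStateEnergy v N (Literature.MathematicalPhysics.QuantumManyBody.BoseGas.sideLength ρ N) + δ → Literature.MathematicalPhysics.QuantumManyBody.BoseGas.periodicEnergy v Φ ≤ Literature.MathematicalPhysics.QuantumManyBody.BoseGas.periodicGroundStateEnergy v N (Literature.MathematicalPhysics.QuantumManyBody.BoseGas.sideLength ρ N) + δ → ∃ c : ℂ, ‖c‖ = 1 ∧ ∫⁻ X in Literature.MathematicalPhysics.QuantumManyBody.BoseGas.cellN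 N (Literature.MathematicalPhysics.QuantumManyBody.BoseGas.sideLength ρ N), (‖Ψ.ψ X - c * Φ.ψ X‖₊ : ENNReal) ^ 2 ≤ ENNReal.ofReal η

/-- item stmt-AtomisticToContinuum-0827 · crux · rank 6 · open · by planner
why it might fail: The hypothesis is ground-state-only at the box (N/ρ)^{1/3}: the Dirichlet ground state restricted to sub-boxes is neither periodic nor of sharp N nor a near-minimiser, so the hypothesis may never fire (transfer ≈ conjunct); BEC is BC-sensitive (Robinson 1976).
sources: LSSY2005, Junge2026, Basti2022, BoccatoSeiringer2023, doi:10.1007/bf01608554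
[crux] BoundaryTransferWeak (mode-free boundary-condition transfer, per potential): for each
repulsive finite-range v, PeriodicBEC(v) implies ∃ρ₀>0 ∀ρ∈(0,ρ₀) HasGroundStateBEC v ρ (Dirichlet
ground state, λ_max(γ) ≥ cN via condensateNumber). Not glue: near-minimiser slacks are O(N/L²) while
Dirichlet/periodic energies differ by a boundary term ≫ N/L², so no energy-comparison proof;
expected route: Neumann bracketing of interior sub-boxes (−Δ_Dir ≥ ⊕−Δ_Neu, v ≥ 0) + a mode-free
criterion (λ_max ≥ tr γ²/N). Only the ENERGY analogue is in print (LiebSeiringerSolovejYngvason2005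
Ch. 2 after (2.8)). v ≡ 0: hypothesis and conclusion both true. -/
@[route_item "route-AtomisticToContinuum-BECNewtonPolicyIteration", crux]
def BoundaryTransferWeak : Prop :=
  ∀ v : ℝ → ENNReal, Literature.MathematicalPhysics.QuantumManyBody.BoseGas.IsRepulsiveFiniteRange v → (∃ ρ₀ : ℝ, 0 < ρ₀ ∧ ∀ ρ : ℝ, 0 < ρ → ρ < ρ₀ → ∃ c : ℝ, 0 < c ∧ ∀ᶠ N : ℕ in Filter.atTop, ∃ δ : ENNReal, 0 < δ ∧ ∀ Ψ : Literature.MathematicalPhysics.QuantumManyBody.BoseGas.PeriodicTrialState N (Literature.MathematicalPhysics.QuantumManyBody.BoseGas.sideLength ρ N), Literature.MathematicalPhysics.QuantumManyBody.BoseGas.periodicEnergy v Ψ ≤ Literature.MathematicalPhysics.QuantumManyBody.BoseGas.periodicGroundStateEnergy v N (Literature.MathematicalPhysics.QuantumManyBody.BoseGas.sideLength ρ N) + δ → ENNReal.ofReal (c * N) ≤ Literature.MathematicalPhysics.QuantumManyBody.BoseGas.condensateOccupation N (Literature.MathematicalPhysics.QuantumManyBody.BoseGas.sideLength ρ N) Ψ.ψ)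 → ∃ ρ₀ : ℝ, 0 < ρ₀ ∧ ∀ ρ : ℝ, 0 < ρ → ρ < ρ₀ → Literature.MathematicalPhysics.QuantumManyBody.BoseGas.HasGroundStateBEC v ρ

/-- item stmt-AtomisticToContinuum-8959 · support · rank 9 · closed · proved by Summit.AtomisticToContinuum.BoseEinsteinCondensation.Theorems.flatModePeriodic_proof @ bc39e139619e (prover) · by planner
sources: PenroseOnsager1956, LSSY2005, Fournais2020
[support] for L > 0 and Ψ ∈ PeriodicTrialState (n+1) L with Ψ ≥ 0 pointwise: (n+1) ≤
condensateOccupation (n+1) L Ψ · ∫_{cell^n} L³ m²/s² dY (Fubini for x::Y on the cell, ∫m = 1 by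
normalisation, Cauchy–Schwarz m = (s L^{−3/2})·(L^{3/2} m/s); condensateOccupation = (n+1) L^{−3}
∫_{cell^n} |∫_cell Ψ(x,Y)dx|² dY by unfolding constantMode and the cell indicators; s = 0 ⇒ m = 0).
[difficulty: provable-now] -/
@[route_item "route-AtomisticToContinuum-BECNewtonPolicyIteration", crux]
def FlatModePeriodic : Prop :=
  ∀ (n : ℕ) (L : ℝ), 0 < L → ∀ Ψ : Literature.MathematicalPhysics.QuantumManyBody.BoseGas.PeriodicTrialState (n + 1) L, (∀ X, Ψ.ψ X = (‖Ψ.ψ X‖ : ℂ)) → ((n + 1 : ℕ) : ENNReal) ≤ Literature.MathematicalPhysics.QuantumManyBody.BoseGas.condensateOccupation (n + 1) L Ψ.ψ * ∫⁻ Y in Literature.MathematicalPhysics.QuantumManyBody.BoseGas.cellN n L, ENNReal.ofReal (L ^ 3) * (∫⁻ x in Literature.MathematicalPhysics.QuantumManyBody.BoseGas.cell L, (‖Ψ.ψ (Matrix.vecCons x Y)‖₊ : ENNReal) ^ 2) ^ 2 / (∫⁻ x in Literature.MathematicalPhysics.QuantumManyBody.BoseGas.cell L, (‖Ψ.ψ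 (Matrix.vecCons x Y)‖₊ : ENNReal)) ^ 2

-- `FlatModePeriodic` holds: proved by `Summit.AtomisticToContinuum.BoseEinsteinCondensation.Theorems.flatModePeriodic_proof` @ bc39e139619e (its module imports this route file, so no `_holds` link can be stated here).

/-- item stmt-AtomisticToContinuum-8960 · support · rank 9 · closed · proved by Summit.AtomisticToContinuum.BoseEinsteinCondensation.Theorems.occupationStabilityPeriodic_proof (prover) · by planner
sources: LSSY2005, Fournais2020
[support] for periodic trial states Ψ, Φ ∈ PeriodicTrialState N L and |c| = 1:
condensateOccupation(Ψ)^{1/2} ≤ condensateOccupation(Φ)^{1/2} + N^{1/2}·‖Ψ − cΦ‖_{L²(cell^N)}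
(F_Ψ(Y) = L^{−3/2}∫_cell Ψ(x,Y)dx, |F_Ψ − cF_Φ|(Y) ≤ ‖(Ψ − cΦ)(·,Y)‖_{L²(cell)} by Cauchy–Schwarz on
the cell, Minkowski in L²(dY), occupation of cΦ = occupation of Φ). [difficulty: provable-now] -/
@[route_item "route-AtomisticToContinuum-BECNewtonPolicyIteration", crux]
def OccupationStabilityPeriodic : Prop :=
  ∀ (N : ℕ) (L : ℝ) (Ψ Φ : Literature.MathematicalPhysics.QuantumManyBody.BoseGas.PeriodicTrialState N L) (c : ℂ), ‖c‖ = 1 → Literature.MathematicalPhysics.QuantumManyBody.BoseGas.condensateOccupation N L Ψ.ψ ^ (1 / 2 : ℝ) ≤ Literature.MathematicalPhysics.QuantumManyBody.BoseGas.condensateOccupation N L Φ.ψ ^ (1 / 2 : ℝ) + (N : ENNReal) ^ (1 / 2 : ℝ) * (∫⁻ X in Literature.MathematicalPhysics.QuantumManyBody.BoseGas.cellN N L, (‖Ψ.ψ X - c * Φ.ψ X‖₊ : ENNReal) ^ 2) ^ (1 / 2 : ℝ)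

-- `OccupationStabilityPeriodic` holds: proved by `Summit.AtomisticToContinuum.BoseEinsteinCondensation.Theorems.occupationStabilityPeriodic_proof` (its module imports this route file, so no `_holds` link can be stated here).

/-- item stmt-AtomisticToContinuum-8961 · support · rank 9 · closed · proved by Summit.AtomisticToContinuum.BoseEinsteinCondensation.Theorems.landscapeToPeriodicBEC_proof (prover) · by planner
sources: LSSY2005, PenroseOnsager1956, Fournais2020
[support] (assembly glue, provable now) PeriodicLandscapeBound → PeriodicRigidity → FlatModePeriodic
→ OccupationStabilityPeriodic → for every admissible v the body of BECPeriodicReduction.PeriodicBEC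
(stmt-0826): ∃ρ₀ ∀ρ<ρ₀ ∃c>0 ∀ᶠN ∃δ>0, every periodic δ-near-minimiser on the torus of side
(N/ρ)^{1/3} has condensateOccupation ≥ cN. Proof: ρ₀ = min of the two ρ₀'s, c = 1/(4C); eventually
in N = n+1 take η = 1/(4C) in PeriodicRigidity to get δ, the positive δ-near-minimiser Ψ of
PeriodicLandscapeBound has condensateOccupation ≥ N/C by FlatModePeriodic, and
OccupationStabilityPeriodic transfers ≥ N/(4C) to every δ-near-minimiser Φ; ENNReal / rpow(1/2) /
`tendsto_add_atTop_nat` bookkeeping only. [difficulty: provable-now] -/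
@[route_item "route-AtomisticToContinuum-BECNewtonPolicyIteration", crux]
def LandscapeToPeriodicBEC : Prop :=
  PeriodicLandscapeBound → PeriodicRigidity → FlatModePeriodic → OccupationStabilityPeriodic → ∀ v : ℝ → ENNReal, Literature.MathematicalPhysics.QuantumManyBody.BoseGas.IsRepulsiveFiniteRange v → ∃ ρ₀ : ℝ, 0 < ρ₀ ∧ ∀ ρ : ℝ, 0 < ρ → ρ < ρ₀ → ∃ c : ℝ, 0 < c ∧ ∀ᶠ N : ℕ in Filter.atTop, ∃ δ : ENNReal, 0 < δ ∧ ∀ Ψ : Literature.MathematicalPhysics.QuantumManyBody.BoseGas.PeriodicTrialState N (Literature.MathematicalPhysics.QuantumManyBody.BoseGas.sideLength ρ N), Literature.MathematicalPhysics.QuantumManyBody.BoseGas.periodicEnergy v Ψ ≤ Literature.MathematicalPhysics.QuantumManyBody.BoseGas.periodicGroundStateEnergy v N (Literature.MathematicalPhysics.QuantumManyBody.BoseGas.sideLength ρ N) + δ → ENNReal.ofReal (c * N) ≤ Literature.MathematicalPhysics.QuantumManyBody.BoseGas.condensateOccupation N (Literature.MathematicalPhysics.QuantumManyBody.BoseGas.sideLength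 ρ N) Ψ.ψ

-- `LandscapeToPeriodicBEC` holds: proved by `Summit.AtomisticToContinuum.BoseEinsteinCondensation.Theorems.landscapeToPeriodicBEC_proof` (its module imports this route file, so no `_holds` link can be stated here).

-- item stmt-AtomisticToContinuum-9319 · support · rank 9 · open · by planner — informal only, no Lean statement yet:
--   [support] POLICY-IMPROVEMENT IDENTITY AND ENERGY BRACKET (fixed N, L; calculus + Perron–Frobenius,
--   provable now once stated over C² data; to be typed with the WeightedCorrector layer). For L > 0, a
--   pair potential v (finite, or ⊤ on cores with F vanishing there), and S, δ : Config N → ℝ of class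
--   C², Lℤ³-periodic in each particle and symmetric, put F = e^{−S}, μ = F²dX/∫_{cell^N}F², E_loc :=
--   (−ΔF + V F)/F = ΔS − |∇S|² + V with V = periodicInteraction v L, Ē := ⟨E_loc⟩_μ (= periodicEnergy of
--   the normalised F, one integration by parts on the torus). If δ solves the weighted Poisson equation
--   weakly

/-- item stmt-AtomisticToContinuum-8962 · assembly · rank 1 · closed · proved by Summit.AtomisticToContinuum.BoseEinsteinCondensation.Theorems.becNewtonPolicyIteration_assembly_proof (prover) · by planner
sources: LSSY2005, PenroseOnsager1956, Fournais2020
[assembly] PeriodicLandscapeBound → PeriodicRigidity → FlatModePeriodic →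
OccupationStabilityPeriodic → LandscapeToPeriodicBEC → BoundaryTransferWeak →
BoseEinsteinCondensation (the sub-problem Statement). -/
@[route_item "route-AtomisticToContinuum-BECNewtonPolicyIteration"]
def Assembly : Prop :=
  PeriodicLandscapeBound → PeriodicRigidity → FlatModePeriodic → OccupationStabilityPeriodic → LandscapeToPeriodicBEC → BoundaryTransferWeak → _root_.BoseEinsteinCondensation

-- `Assembly` holds: proved by `Summit.AtomisticToContinuum.BoseEinsteinCondensation.Theorems.becNewtonPolicyIteration_assembly_proof` (its module imports this route file, so no `_holds` link can be stated here).

/-! D-0027 §2.1 — DECIDING THEOREM (planner-authored via `route open/edit --closes-file`; by planner-rrepair-AtomisticToContinuum-BECNewton-d45a90cc-g2-0 2026-08-15T16:27:33Z):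
its hypotheses are this route's items and its conclusion the sub-problem Statement (glue_lint), and it elaborates with this file. -/

@[closes "route-AtomisticToContinuum-BECNewtonPolicyIteration"] theorem closes (h₁ : PeriodicLandscapeBound) (h₂ : PeriodicRigidity) (h₃ : FlatModePeriodic)
    (h₄ : OccupationStabilityPeriodic) (h₅ : LandscapeToPeriodicBEC) (h₆ : BoundaryTransferWeak) :
    _root_.BoseEinsteinCondensation :=
  fun v hv => h₆ v hv (h₅ h₁ h₂ h₃ h₄ v hv)

end Summit.AtomisticToContinuum.BoseEinsteinCondensation.Theses.BECNewtonPolicyIteration
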